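import Mathlib
import Literature.AlgebraicGeometry.Resolution.CobordantTupleGame
import Literature.AlgebraicGeometry.Resolution.CobordantChartCoefficients
import Literature.AlgebraicGeometry.Resolution.PlaneGermBlowup
import Summits.ResolutionOfSingularities.ResolutionOfSingularities.Theorems.WeightedInvariantLocalWeightedDropPlaneBranchDropOfCount
import Summits.ResolutionOfSingularities.ResolutionOfSingularities.Theorems.WeightedInvariantLocalWeightedDropPlaneMonomialPhaseAux
import Summits.ResolutionOfSingularities.ResolutionOfSingularities.Theorems.WeightedInvariantLocalWeightedDropPlaneMonomialPhaseAux2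

/-!
# `WeightedInvariant.LocalWeightedDrop`, line `hasse-ridge-face-selection`: the monomial phase of the plane tuple game

Crux item stmt-ResolutionOfSingularities-8899 (route `ResolutionOfSingularities/WeightedInvariant`), skeleton v16 of
the line, stub `stub_planeMonomialPhase` (every field `k`).  A rank `μ < ω²` on tuples
`a : Fin (e + 1) → k[[x, y]]` of plane germs (markings `m_j = e + 2 - j`) such that from every non-zero bad tuple whose
support product `Π_{a_j ≠ 0} a_j` is a normal crossing some smooth-centre move keeps the support a normal crossing
and drops `μ` at every non-zero bad successor (`TupleGame.StepDrop`).

Proof.  A PRESENTATION of `a` is a legal coordinate change `Φ` with `a_j ∘ Φ = u_j · x^{α_j} · y^{β_j}`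
(`u_j(0) ≠ 0`) for every non-zero entry; it exists as soon as the support product is a normal crossing
(`PlaneMonomialPhase.exists_presentation`: divisors of `u xᵃ yᶜ` are unit monomials in the same coordinates).
Normalise the exponents to the common marking `L = (e + 2)!`: `Â_j = α_j · L/m_j`, `B̂_j = β_j · L/m_j`, and let
`pot = ω · spread + S_min` be the potential of the cloud `(Â_j, B̂_j)_{a_j ≠ 0}` (`PlaneMonomialPhase.pot`:
`S_min = min (Â + B̂)`, `spread = (Â at min B̂ − min Â) + (B̂ at min Â − min B̂)`); `μ a` is the least potential of
a presentation (`0` if there is none), an ordinal `< ω²`.  THE MOVE, read off a minimising presentation: `Φ` and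
the curve `x = 0` (`w = (1, 0)`) if `α_j ≥ m_j` for all `j`, else the curve `y = 0` if `β_j ≥ m_j` for all `j`, else
the point (`w = (1, 1)`; `α_j + β_j ≥ m_j` by badness).  Under the chart the entry `u x^α y^β` becomes
`s^{w₀α + w₁β} · U (c₀ + y₀')^α (c₁ + y₁')^β` with `s ∤` the bracket, so these are the factorisation data `(D_j, G_j)`
(`stub_planeMonomialPhaseChart`), the floor weight `W` is `≥ 1`, and the successor tuple at the live slot is again
presented by the IDENTITY with exponents: curve `x` — `(α_j − m_j W, β_j)`, all normalised points shift by `L W`,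
spread fixed, `S_min` drops (`shift_lt`); curve `y` — symmetric; point, corner `c = (c₀, 0)` —
`(α_j + β_j − m_j W, β_j)`, a shear of the cloud under which `ω · spread + S_min` drops (`stub_planeMonomialPhaseShear`:
the new spread is `Â@B̂min − Â_Q ≤ spread`, strictly unless the componentwise minimum is attained, where
`S_min' ≤ S_min + B̂_min − L W < S_min` because the `y`-curve was not bad); corner `(0, c₁)` — symmetric; off the
corners every new entry is `unit · s^{D_j − m_j W}` and some `D_j − m_j W < m_j`
(`TupleGame.exists_lt_marking_mul_floorWeight_succ`), so the successor is not bad.  The support product of a tuple of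
unit monomials is a unit monomial, hence a normal crossing.
-/

set_option linter.dupNamespace false -- mandated namespace of this single-conjunct summit

namespace Summit.ResolutionOfSingularities.ResolutionOfSingularities.Theorems

open Literature.AlgebraicGeometry.Resolution

namespace PlaneMonomialPhase

open MvPowerSeries

variable {k : Type} [Field k]

/-! ### The potential `ω · spread + S_min` of an exponent cloud -/

/-- THE POTENTIAL OF AN EXPONENT CLOUD `(A_i, B_i)_i`: `ω · spread + S_min` with `S_min = ⨅ (A_i + B_i)` and
`spread = (⨅{A_i : B_i = B_min} - A_min) + (⨅{B_i : A_i = A_min} - B_min)` — the taxicab extent of the staircase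
of componentwise-minimal points. -/
noncomputable def pot {ι : Type} (A B : ι → ℕ) : Ordinal.{0} :=
  Ordinal.omega0 * (((⨅ i : {i // B i = iInf B}, A i.1) - iInf A +
      ((⨅ i : {i // A i = iInf A}, B i.1) - iInf B) : ℕ) : Ordinal.{0}) +
    ((⨅ i, (A i + B i) : ℕ) : Ordinal.{0})

/-- `pot < ω²`. -/
theorem pot_lt_omega0_sq {ι : Type} (A B : ι → ℕ) : pot A B < Ordinal.omega0 ^ 2 := by
  unfold pot
  generalize ((⨅ i : {i // B i = iInf B}, A i.1) - iInf A + ((⨅ i : {i // A i = iInf A}, B i.1) - iInf B) : ℕ) = n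
  generalize (⨅ i, (A i + B i) : ℕ) = m
  calc Ordinal.omega0 * (n : Ordinal.{0}) + (m : Ordinal.{0})
      < Ordinal.omega0 * (n : Ordinal.{0}) + Ordinal.omega0 :=
        (add_lt_add_iff_left _).mpr (Ordinal.natCast_lt_omega0 m)
    _ = Ordinal.omega0 * ((n + 1 : ℕ) : Ordinal.{0}) := by rw [Nat.cast_succ, mul_add_one]
    _ ≤ Ordinal.omega0 * Ordinal.omega0 := mul_le_mul_right (Ordinal.natCast_lt_omega0 _).le _
    _ = Ordinal.omega0 ^ 2 := (pow_two _).symm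

/-- The potential is symmetric in the two coordinates. -/
theorem pot_symm {ι : Type} (A B : ι → ℕ) : pot A B = pot B A := by
  unfold pot
  have h : (fun i => B i + A i) = (fun i => A i + B i) := funext fun i => Nat.add_comm _ _
  rw [h, Nat.add_comm ((⨅ i : {i // B i = iInf B}, A i.1) - iInf A)]

/-- THE CURVE MOVE along `x`: `(A, B) ↦ (A - t, B)`, `0 < t ≤ A_i`, lowers the potential. -/
theorem pot_shift {ι : Type} [Nonempty ι] (A B : ι → ℕ) {t : ℕ} (ht : 0 < t) (hA : ∀ i, t ≤ A i) :
    pot (fun i => A i - t) B < pot A B := by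
  unfold pot
  exact shift_lt A B ht hA

/-- THE CURVE MOVE along `y` (the successor's first exponent is the old second one). -/
theorem pot_shift' {ι : Type} [Nonempty ι] (A B : ι → ℕ) {t : ℕ} (ht : 0 < t) (hB : ∀ i, t ≤ B i) :
    pot (fun i => B i - t) A < pot A B := by
  rw [pot_symm A B]
  exact pot_shift B A ht hB

/-- THE CORNER POINT MOVE towards `x`: `(A, B) ↦ (A + B - t, B)`, `t ≤ A_i + B_i`, some `B_i < t`. -/
theorem pot_shear {ι : Type} [Nonempty ι] (A B : ι → ℕ) {t : ℕ} (hS : ∀ i, t ≤ A i + B i)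
    (hB : ∃ i, B i < t) : pot (fun i => A i + B i - t) B < pot A B := by
  unfold pot
  exact shear_lt A B hS hB

/-- THE CORNER POINT MOVE towards `y`: `(A, B) ↦ (A + B - t, A)`, `t ≤ A_i + B_i`, some `A_i < t`. -/
theorem pot_shear' {ι : Type} [Nonempty ι] (A B : ι → ℕ) {t : ℕ} (hS : ∀ i, t ≤ A i + B i)
    (hA : ∃ i, A i < t) : pot (fun i => A i + B i - t) A < pot A B := by
  have h : (fun i => A i + B i - t) = (fun i => B i + A i - t) := funext fun i => by rw [Nat.add_comm]
  rw [h, pot_symm A B]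
  exact pot_shear B A (fun i => by rw [Nat.add_comm]; exact hS i) hA

/-! ### The normalised potential of a presentation and the rank `μ` -/

/-- THE NORMALISED POTENTIAL of exponents `(α, β)` over the support predicate `P`: the potential of the cloud
`(α_j · L/m_j, β_j · L/m_j)_{P j}`, `L = (e + 2)!`, `m_j = TupleGame.marking e j`. -/
noncomputable def presPot (e : ℕ) (P : Fin (e + 1) → Prop) (α β : Fin (e + 1) → ℕ) : Ordinal.{0} :=
  pot (fun j : {j // P j} => α j.1 * ((e + 2).factorial / TupleGame.marking e j.1))
    (fun j : {j // P j} => β j.1 * ((e + 2).factorial / TupleGame.marking e j.1))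

/-- The normalised potential only depends on the exponents on the support. -/
theorem presPot_congr {e : ℕ} {P : Fin (e + 1) → Prop} {α β α' β' : Fin (e + 1) → ℕ}
    (hα : ∀ j, P j → α j = α' j) (hβ : ∀ j, P j → β j = β' j) : presPot e P α β = presPot e P α' β' := by
  unfold presPot
  congr 1
  · funext j
    rw [hα j.1 j.2]
  · funext j
    rw [hβ j.1 j.2]

/-- CURVE `x`: the exponents `(α_j - m_j W, β_j)` have smaller normalised potential (`W ≥ 1`, `m_j W ≤ α_j`). -/
theorem presPot_curve {e : ℕ} {P : Fin (e + 1) → Prop} (hP : ∃ j, P j) {α : Fin (e + 1) → ℕ}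
    (β : Fin (e + 1) → ℕ) {W : ℕ} (hW : 0 < W) (hD : ∀ j, P j → TupleGame.marking e j * W ≤ α j) :
    presPot e P (fun j => α j - TupleGame.marking e j * W) β < presPot e P α β := by
  obtain ⟨j₀, hj₀⟩ := hP
  haveI : Nonempty {j // P j} := ⟨⟨j₀, hj₀⟩⟩
  simp only [presPot]
  have h : (fun j : {j // P j} => (α j.1 - TupleGame.marking e j.1 * W) *
      ((e + 2).factorial / TupleGame.marking e j.1)) = fun j : {j // P j} =>
      α j.1 * ((e + 2).factorial / TupleGame.marking e j.1) - (e + 2).factorial * W := by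
    funext j
    rw [Nat.sub_mul, Nat.mul_right_comm, marking_mul_scale]
  rw [h]
  exact pot_shift _ _ (Nat.mul_pos (Nat.factorial_pos _) hW) fun j => by
    have := Nat.mul_le_mul_right ((e + 2).factorial / TupleGame.marking e j.1) (hD j.1 j.2)
    rwa [Nat.mul_right_comm, marking_mul_scale] at this

/-- CURVE `y`: the exponents `(β_j - m_j W, α_j)` have smaller normalised potential (`W ≥ 1`, `m_j W ≤ β_j`). -/
theorem presPot_curve' {e : ℕ} {P : Fin (e + 1) → Prop} (hP : ∃ j, P j) (α : Fin (e + 1) → ℕ)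
    {β : Fin (e + 1) → ℕ} {W : ℕ} (hW : 0 < W) (hD : ∀ j, P j → TupleGame.marking e j * W ≤ β j) :
    presPot e P (fun j => β j - TupleGame.marking e j * W) α < presPot e P α β := by
  obtain ⟨j₀, hj₀⟩ := hP
  haveI : Nonempty {j // P j} := ⟨⟨j₀, hj₀⟩⟩
  simp only [presPot]
  have h : (fun j : {j // P j} => (β j.1 - TupleGame.marking e j.1 * W) *
      ((e + 2).factorial / TupleGame.marking e j.1)) = fun j : {j // P j} =>
      β j.1 * ((e + 2).factorial / TupleGame.marking e j.1) - (e + 2).factorial * W := by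
    funext j
    rw [Nat.sub_mul, Nat.mul_right_comm, marking_mul_scale]
  rw [h]
  exact pot_shift' _ _ (Nat.mul_pos (Nat.factorial_pos _) hW) fun j => by
    have := Nat.mul_le_mul_right ((e + 2).factorial / TupleGame.marking e j.1) (hD j.1 j.2)
    rwa [Nat.mul_right_comm, marking_mul_scale] at this

/-- A non-bad entry gives a normalised exponent below `L W`. -/
theorem scaled_lt {e : ℕ} {γ : Fin (e + 1) → ℕ} {j : Fin (e + 1)} (hlt : γ j < TupleGame.marking e j) {W : ℕ}
    (hW : 0 < W) : γ j * ((e + 2).factorial / TupleGame.marking e j) < (e + 2).factorial * W :=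
  calc γ j * ((e + 2).factorial / TupleGame.marking e j)
      < TupleGame.marking e j * ((e + 2).factorial / TupleGame.marking e j) :=
        Nat.mul_lt_mul_of_pos_right hlt (scale_pos e j)
    _ = (e + 2).factorial := marking_mul_scale e j
    _ ≤ (e + 2).factorial * W := Nat.le_mul_of_pos_right _ hW

/-- POINT, corner `(c₀, 0)`: the exponents `(α_j + β_j - m_j W, β_j)` have smaller normalised potential
(`W ≥ 1`, `m_j W ≤ α_j + β_j`, and some `β_j < m_j` — the `y`-curve was not bad). -/
theorem presPot_point {e : ℕ} {P : Fin (e + 1) → Prop} (hP : ∃ j, P j) {α β : Fin (e + 1) → ℕ} {W : ℕ}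
    (hW : 0 < W) (hD : ∀ j, P j → TupleGame.marking e j * W ≤ α j + β j)
    (hβ : ∃ j, P j ∧ β j < TupleGame.marking e j) :
    presPot e P (fun j => α j + β j - TupleGame.marking e j * W) β < presPot e P α β := by
  obtain ⟨j₀, hj₀⟩ := hP
  haveI : Nonempty {j // P j} := ⟨⟨j₀, hj₀⟩⟩
  simp only [presPot]
  have h : (fun j : {j // P j} => (α j.1 + β j.1 - TupleGame.marking e j.1 * W) *
      ((e + 2).factorial / TupleGame.marking e j.1)) = fun j : {j // P j} =>
      α j.1 * ((e + 2).factorial / TupleGame.marking e j.1) +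
        β j.1 * ((e + 2).factorial / TupleGame.marking e j.1) - (e + 2).factorial * W := by
    funext j
    rw [Nat.sub_mul, Nat.add_mul, Nat.mul_right_comm, marking_mul_scale]
  rw [h]
  refine pot_shear _ _ (fun j => ?_) ?_
  · have := Nat.mul_le_mul_right ((e + 2).factorial / TupleGame.marking e j.1) (hD j.1 j.2)
    rwa [Nat.mul_right_comm, marking_mul_scale, Nat.add_mul] at this
  · obtain ⟨j, hj, hlt⟩ := hβ
    exact ⟨⟨j, hj⟩, scaled_lt hlt hW⟩

/-- POINT, corner `(0, c₁)`: the exponents `(α_j + β_j - m_j W, α_j)` have smaller normalised potential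
(`W ≥ 1`, `m_j W ≤ α_j + β_j`, and some `α_j < m_j` — the `x`-curve was not bad). -/
theorem presPot_point' {e : ℕ} {P : Fin (e + 1) → Prop} (hP : ∃ j, P j) {α β : Fin (e + 1) → ℕ} {W : ℕ}
    (hW : 0 < W) (hD : ∀ j, P j → TupleGame.marking e j * W ≤ α j + β j)
    (hα : ∃ j, P j ∧ α j < TupleGame.marking e j) :
    presPot e P (fun j => α j + β j - TupleGame.marking e j * W) α < presPot e P α β := by
  obtain ⟨j₀, hj₀⟩ := hP
  haveI : Nonempty {j // P j} := ⟨⟨j₀, hj₀⟩⟩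
  simp only [presPot]
  have h : (fun j : {j // P j} => (α j.1 + β j.1 - TupleGame.marking e j.1 * W) *
      ((e + 2).factorial / TupleGame.marking e j.1)) = fun j : {j // P j} =>
      α j.1 * ((e + 2).factorial / TupleGame.marking e j.1) +
        β j.1 * ((e + 2).factorial / TupleGame.marking e j.1) - (e + 2).factorial * W := by
    funext j
    rw [Nat.sub_mul, Nat.add_mul, Nat.mul_right_comm, marking_mul_scale]
  rw [h]
  refine pot_shear' _ _ (fun j => ?_) ?_
  · have := Nat.mul_le_mul_right ((e + 2).factorial / TupleGame.marking e j.1) (hD j.1 j.2)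
    rwa [Nat.mul_right_comm, marking_mul_scale, Nat.add_mul] at this
  · obtain ⟨j, hj, hlt⟩ := hα
    exact ⟨⟨j, hj⟩, scaled_lt hlt hW⟩

/-- THE RANK `μ a`: the least normalised potential of a presentation of `a` (a legal `Φ` with
`a_j ∘ Φ = u_j · x^{α_j} · y^{β_j}`, `u_j(0) ≠ 0`, for every non-zero entry); `0` if there is none. -/
noncomputable def mu {e : ℕ} (a : Fin (e + 1) → MvPowerSeries (Fin 2) k) : Ordinal.{0} :=
  sInf {o | ∃ (Φ : Fin 2 → MvPowerSeries (Fin 2) k) (α β : Fin (e + 1) → ℕ),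
    (∀ i, constantCoeff (Φ i) = 0) ∧
    IsUnit (Matrix.det (Matrix.of fun i j => coeff (Finsupp.single j 1) (Φ i))) ∧
    (∀ j, a j ≠ 0 → ∃ u : MvPowerSeries (Fin 2) k, constantCoeff u ≠ 0 ∧
      subst Φ (a j) = u * X 0 ^ α j * X 1 ^ β j) ∧
    o = presPot e (fun j => a j ≠ 0) α β}

/-- `μ a` is at most the potential of any presentation. -/
theorem mu_le {e : ℕ} {a : Fin (e + 1) → MvPowerSeries (Fin 2) k} {Φ : Fin 2 → MvPowerSeries (Fin 2) k}
    {α β : Fin (e + 1) → ℕ} (hΦ0 : ∀ i, constantCoeff (Φ i) = 0)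
    (hdet : IsUnit (Matrix.det (Matrix.of fun i j => coeff (Finsupp.single j 1) (Φ i))))
    (hpres : ∀ j, a j ≠ 0 → ∃ u : MvPowerSeries (Fin 2) k, constantCoeff u ≠ 0 ∧
      subst Φ (a j) = u * X 0 ^ α j * X 1 ^ β j) :
    mu a ≤ presPot e (fun j => a j ≠ 0) α β :=
  csInf_le' ⟨Φ, α, β, hΦ0, hdet, hpres, rfl⟩

/-- If `a` has a presentation then `μ a` is attained by one. -/
theorem mu_mem {e : ℕ} {a : Fin (e + 1) → MvPowerSeries (Fin 2) k}
    (h : ∃ (Φ : Fin 2 → MvPowerSeries (Fin 2) k) (α β : Fin (e + 1) → ℕ),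
      (∀ i, constantCoeff (Φ i) = 0) ∧
      IsUnit (Matrix.det (Matrix.of fun i j => coeff (Finsupp.single j 1) (Φ i))) ∧
      (∀ j, a j ≠ 0 → ∃ u : MvPowerSeries (Fin 2) k, constantCoeff u ≠ 0 ∧
        subst Φ (a j) = u * X 0 ^ α j * X 1 ^ β j)) :
    ∃ (Φ : Fin 2 → MvPowerSeries (Fin 2) k) (α β : Fin (e + 1) → ℕ),
      (∀ i, constantCoeff (Φ i) = 0) ∧
      IsUnit (Matrix.det (Matrix.of fun i j => coeff (Finsupp.single j 1) (Φ i))) ∧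
      (∀ j, a j ≠ 0 → ∃ u : MvPowerSeries (Fin 2) k, constantCoeff u ≠ 0 ∧
        subst Φ (a j) = u * X 0 ^ α j * X 1 ^ β j) ∧
      presPot e (fun j => a j ≠ 0) α β = mu a := by
  obtain ⟨Φ, α, β, h1, h2, h3⟩ := h
  set S : Set Ordinal.{0} := {o | ∃ (Φ : Fin 2 → MvPowerSeries (Fin 2) k) (α β : Fin (e + 1) → ℕ),
    (∀ i, constantCoeff (Φ i) = 0) ∧
    IsUnit (Matrix.det (Matrix.of fun i j => coeff (Finsupp.single j 1) (Φ i))) ∧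
    (∀ j, a j ≠ 0 → ∃ u : MvPowerSeries (Fin 2) k, constantCoeff u ≠ 0 ∧
      subst Φ (a j) = u * X 0 ^ α j * X 1 ^ β j) ∧
    o = presPot e (fun j => a j ≠ 0) α β} with hS
  have hmem : sInf S ∈ S := csInf_mem ⟨_, Φ, α, β, h1, h2, h3, rfl⟩
  obtain ⟨Φ', α', β', h1', h2', h3', ho⟩ := hmem
  exact ⟨Φ', α', β', h1', h2', h3', ho.symm⟩

/-- `μ a < ω²`. -/
theorem mu_lt_omega0_sq {e : ℕ} (a : Fin (e + 1) → MvPowerSeries (Fin 2) k) : mu a < Ordinal.omega0 ^ 2 := by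
  by_cases h : ∃ (Φ : Fin 2 → MvPowerSeries (Fin 2) k) (α β : Fin (e + 1) → ℕ),
      (∀ i, constantCoeff (Φ i) = 0) ∧
      IsUnit (Matrix.det (Matrix.of fun i j => coeff (Finsupp.single j 1) (Φ i))) ∧
      (∀ j, a j ≠ 0 → ∃ u : MvPowerSeries (Fin 2) k, constantCoeff u ≠ 0 ∧
        subst Φ (a j) = u * X 0 ^ α j * X 1 ^ β j)
  · obtain ⟨Φ, α, β, h1, h2, h3⟩ := h
    exact (mu_le h1 h2 h3).trans_lt (pot_lt_omega0_sq _ _)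
  · have h0 : mu a = 0 := by
      unfold mu
      convert Ordinal.sInf_empty
      ext o
      simp only [Set.mem_setOf_eq, Set.mem_empty_iff_false, iff_false]
      rintro ⟨Φ, α, β, h1, h2, h3, -⟩
      exact h ⟨Φ, α, β, h1, h2, h3⟩
    rw [h0]
    exact pow_pos Ordinal.omega0_pos 2

/-! ### The step -/

/-- BOOKKEEPING OF A GOOD SUCCESSOR: if the successor `b` of `a` is a tuple of unit monomials with exponents
`(α', β')` on the support of `a` (and zero off it) whose normalised potential is below that of a minimising
presentation of `a`, then `b` has normal-crossing support product and `μ b < μ a`. -/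
theorem finish {e : ℕ} {a b : Fin (e + 1) → MvPowerSeries (Fin 2) k} {α' β' : Fin (e + 1) → ℕ}
    (hb : ∀ j, a j ≠ 0 → ∃ u : MvPowerSeries (Fin 2) k, constantCoeff u ≠ 0 ∧
      b j = u * X 0 ^ α' j * X 1 ^ β' j)
    (hb0 : ∀ j, a j = 0 → b j = 0) {α β : Fin (e + 1) → ℕ} (hmin : presPot e (fun j => a j ≠ 0) α β = mu a)
    (hlt : presPot e (fun j => a j ≠ 0) α' β' < presPot e (fun j => a j ≠ 0) α β) :
    PlaneGerm.IsNC (TupleGame.prodSupport b) ∧ mu b < mu a := by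
  have hsupp : (fun j => b j ≠ 0) = (fun j => a j ≠ 0) := by
    funext j
    refine propext ⟨fun h h0 => h (hb0 j h0), fun h h0 => ?_⟩
    obtain ⟨u, hu, hj⟩ := hb j h
    exact unitMonomial_ne_zero hu _ _ (hj ▸ h0)
  have hb' : ∀ j, b j ≠ 0 → ∃ u : MvPowerSeries (Fin 2) k, constantCoeff u ≠ 0 ∧
      b j = u * X 0 ^ α' j * X 1 ^ β' j := fun j hj => hb j ((congrFun hsupp j).mp hj)
  refine ⟨isNC_prodSupport b fun j hj => ?_, ?_⟩
  · obtain ⟨u, hu, h⟩ := hb' j hj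
    exact ⟨u, _, _, hu, h⟩
  · calc mu b ≤ presPot e (fun j => b j ≠ 0) α' β' :=
          mu_le (fun i => constantCoeff_X i) PlaneBranchDropOfCount.isUnit_det_X fun j hj => by
            obtain ⟨u, hu, h⟩ := hb' j hj
            exact ⟨u, hu, by rw [subst_self]; exact h⟩
      _ = presPot e (fun j => a j ≠ 0) α' β' := by rw [hsupp]
      _ < presPot e (fun j => a j ≠ 0) α β := hlt
      _ = mu a := hmin

/-- THE STEP OF THE MONOMIAL PHASE: from a non-zero bad tuple with normal-crossing support product, the move read off
a minimising presentation keeps the support a normal crossing and drops `μ` at every non-zero bad successor. -/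
theorem stepDrop {e : ℕ} (a : Fin (e + 1) → MvPowerSeries (Fin 2) k) (ha : a ≠ 0) (hbad : TupleGame.Bad a)
    (hnc : PlaneGerm.IsNC (TupleGame.prodSupport a)) :
    TupleGame.StepDrop mu (fun b => PlaneGerm.IsNC (TupleGame.prodSupport b)) a := by
  classical
  -- a presentation realising `μ a`
  obtain ⟨Φ₁, hΦ₁0, hΦ₁det, hex⟩ := exists_presentation a hnc
  choose α₁ β₁ hαβ₁ using hex
  obtain ⟨Φ, α, β, hΦ0, hdet, hpres, hmin⟩ := mu_mem (a := a) ⟨Φ₁, α₁, β₁, hΦ₁0, hΦ₁det, hαβ₁⟩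
  have hP : ∃ j, a j ≠ 0 := by
    by_contra h
    push Not at h
    exact ha (funext h)
  have hsum : ∀ j, a j ≠ 0 → TupleGame.marking e j ≤ α j + β j := fun j hj => by
    obtain ⟨u, hu, h⟩ := hpres j hj
    exact marking_le_add hbad hΦ0 hj hu h
  unfold TupleGame.StepDrop
  by_cases hx : ∀ j, a j ≠ 0 → TupleGame.marking e j ≤ α j
  · -- THE `x`-CURVE MOVE `(Φ, (1, 0))`: exceptional points `c = (c₀, 0)`, slot `0`
    refine ⟨Φ, ![1, 0], hΦ0, hdet, fun i => by fin_cases i <;> simp, ⟨0, by simp⟩,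
      fun c hconv hc D G hfac => ?_⟩
    have hc1 : c 1 = 0 := hconv 1 (by simp)
    have hc0 : c 0 ≠ 0 := fun h0 => hc (funext fun i => by fin_cases i <;> assumption)
    obtain ⟨hD, hnew⟩ := newTuple_slot0 hpres _ c hconv hc0 D G hfac
    have hD' : ∀ j, a j ≠ 0 → D j = α j := fun j hj => by rw [hD j hj]; simp
    have hW : 0 < TupleGame.floorWeight a D := one_le_floorWeight ha D fun j hj => (hD' j hj).symm ▸ hx j hj
    refine ⟨0, hc0, fun _ _ => finish hnew (fun j hj => newTuple_of_eq_zero D G 0 hj) hmin ?_⟩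
    refine (presPot_congr (fun j hj => ?_) (fun j _ => if_pos hc1)).trans_lt
      (presPot_curve hP β hW fun j hj => (hD' j hj) ▸ TupleGame.marking_mul_floorWeight_le D hj)
    simp only [hD' j hj]
  by_cases hy : ∀ j, a j ≠ 0 → TupleGame.marking e j ≤ β j
  · -- THE `y`-CURVE MOVE `(Φ, (0, 1))`: exceptional points `c = (0, c₁)`, slot `1`
    refine ⟨Φ, ![0, 1], hΦ0, hdet, fun i => by fin_cases i <;> simp, ⟨1, by simp⟩,
      fun c hconv hc D G hfac => ?_⟩
    have hc0 : c 0 = 0 := hconv 0 (by simp)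
    have hc1 : c 1 ≠ 0 := fun h1 => hc (funext fun i => by fin_cases i <;> assumption)
    obtain ⟨hD, hnew⟩ := newTuple_slot1 hpres _ c hconv hc1 D G hfac
    have hD' : ∀ j, a j ≠ 0 → D j = β j := fun j hj => by rw [hD j hj]; simp
    have hW : 0 < TupleGame.floorWeight a D := one_le_floorWeight ha D fun j hj => (hD' j hj).symm ▸ hy j hj
    refine ⟨1, hc1, fun _ _ => finish hnew (fun j hj => newTuple_of_eq_zero D G 1 hj) hmin ?_⟩
    refine (presPot_congr (fun j hj => ?_) (fun j _ => if_pos hc0)).trans_lt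
      (presPot_curve' hP α hW fun j hj => (hD' j hj) ▸ TupleGame.marking_mul_floorWeight_le D hj)
    simp only [hD' j hj]
  -- THE POINT MOVE `(Φ, (1, 1))`
  push Not at hx hy
  refine ⟨Φ, ![1, 1], hΦ0, hdet, fun i => by fin_cases i <;> simp, ⟨0, by simp⟩,
    fun c hconv hc D G hfac => ?_⟩
  by_cases hc0 : c 0 = 0
  · -- the corner `c = (0, c₁)`: slot `1`, shear towards `y`
    have hc1 : c 1 ≠ 0 := fun h1 => hc (funext fun i => by fin_cases i <;> assumption)
    obtain ⟨hD, hnew⟩ := newTuple_slot1 hpres _ c hconv hc1 D G hfac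
    have hD' : ∀ j, a j ≠ 0 → D j = α j + β j := fun j hj => by rw [hD j hj]; simp
    have hW : 0 < TupleGame.floorWeight a D :=
      one_le_floorWeight ha D fun j hj => (hD' j hj).symm ▸ hsum j hj
    refine ⟨1, hc1, fun _ _ => finish hnew (fun j hj => newTuple_of_eq_zero D G 1 hj) hmin ?_⟩
    refine (presPot_congr (fun j hj => ?_) (fun j _ => if_pos hc0)).trans_lt
      (presPot_point' hP hW (fun j hj => (hD' j hj) ▸ TupleGame.marking_mul_floorWeight_le D hj) hx)
    simp only [hD' j hj]
  · obtain ⟨hD, hnew⟩ := newTuple_slot0 hpres _ c hconv hc0 D G hfac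
    have hD' : ∀ j, a j ≠ 0 → D j = α j + β j := fun j hj => by rw [hD j hj]; simp
    have hW : 0 < TupleGame.floorWeight a D :=
      one_le_floorWeight ha D fun j hj => (hD' j hj).symm ▸ hsum j hj
    by_cases hc1 : c 1 = 0
    · -- the corner `c = (c₀, 0)`: slot `0`, shear towards `x`
      refine ⟨0, hc0, fun _ _ => finish hnew (fun j hj => newTuple_of_eq_zero D G 0 hj) hmin ?_⟩
      refine (presPot_congr (fun j hj => ?_) (fun j _ => if_pos hc1)).trans_lt
        (presPot_point hP hW (fun j hj => (hD' j hj) ▸ TupleGame.marking_mul_floorWeight_le D hj) hy)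
      simp only [hD' j hj]
    · -- off the corners: some new entry `unit · s^{D_j - m_j W}` has order `< m_j`, the successor is not bad
      refine ⟨0, hc0, fun _ hbad' => absurd hbad' ?_⟩
      obtain ⟨j, hj, hlt⟩ := TupleGame.exists_lt_marking_mul_floorWeight_succ ha D
      obtain ⟨u, hu, hju⟩ := hnew j hj
      rw [if_neg hc1] at hju
      refine not_bad_of_lt hu hju ?_
      have := TupleGame.marking_mul_floorWeight_le D hj
      rw [Nat.mul_succ] at hlt
      omega

end PlaneMonomialPhase

/-- S3b — THE MONOMIAL PHASE OF THE PLANE TUPLE GAME (stub `stub_planeMonomialPhase` of the line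
`hasse-ridge-face-selection`, crux `LocalWeightedDrop`, stmt-ResolutionOfSingularities-8899; every field).  A rank `μ < ω²`
on tuples of plane germs such that from every non-zero bad tuple whose support product is a normal crossing some
smooth-centre move keeps the support a normal crossing and drops `μ` at every non-zero bad successor: `μ` is the least
potential `ω · spread + S_min` of the normalised exponent cloud of a presentation (`PlaneMonomialPhase.mu`), and the move is
"bad curve first, else the point" read off a minimising presentation (`PlaneMonomialPhase.stepDrop`). -/
theorem stub_planeMonomialPhase : ∀ (k : Type) [Field k] (e : ℕ),
    ∃ μ : (Fin (e + 1) → MvPowerSeries (Fin 2) k) → Ordinal.{0},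
      (∀ a, μ a < Ordinal.omega0 ^ 2) ∧
      ∀ a : Fin (e + 1) → MvPowerSeries (Fin 2) k, a ≠ 0 → TupleGame.Bad a →
        PlaneGerm.IsNC (TupleGame.prodSupport a) →
        TupleGame.StepDrop μ (fun b => PlaneGerm.IsNC (TupleGame.prodSupport b)) a := by
  intro k _ e
  exact ⟨PlaneMonomialPhase.mu, PlaneMonomialPhase.mu_lt_omega0_sq, PlaneMonomialPhase.stepDrop⟩

end Summit.ResolutionOfSingularities.ResolutionOfSingularities.Theorems
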